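import Mathlib
import HarnessLib
import Summits.ValiantsHypothesis.ValiantsHypothesis.Theses.MonotoneRestoration
import Literature.Computability.AlgebraicComplexity.ArithCircuit
import Literature.Computability.AlgebraicComplexity.ArithCircuitProofs
import Literature.Computability.AlgebraicComplexity.MonotoneStructure
import Literature.Computability.AlgebraicComplexity.PermanentIrreducible
import Literature.ModelTheory.FiniteModelTheory.CkEquiv
import Summits.ValiantsHypothesis.ValiantsHypothesis.Theorems.MonotoneRestorationMonotoneRestorationQPCosetCount
import Summits.ValiantsHypothesis.ValiantsHypothesis.Theorems.MonotoneRestorationMonotoneRestorationQPSymmetricLB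
import Summits.ValiantsHypothesis.ValiantsHypothesis.Theorems.MonotoneRestorationMonotoneRestorationQPSupportSymmetrisation
import Summits.ValiantsHypothesis.ValiantsHypothesis.Theorems.MonotoneRestorationMonotoneRestorationQPSparseRegime
import Summits.ValiantsHypothesis.ValiantsHypothesis.Theorems.MonotoneRestorationMonotoneRestorationQPBeta
import Literature.Computability.AlgebraicComplexity.SymmetricArithCircuit
import Literature.Computability.AlgebraicComplexity.DawarWilsenach2025Proofs
import Literature.GroupTheory.PermutationGroups.SmallIndexSubgroups
import Summits.ValiantsHypothesis.ValiantsHypothesis.Theorems.MonotoneRestorationQP.Negative.LoadBearing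
import Summits.ValiantsHypothesis.ValiantsHypothesis.Theorems.MonotoneRestorationMonotoneRestorationQPPermSupportCount

/-! TTRL-lite variant V22064 of stmt-ValiantsHypothesis-15886

Algebraic half of the domination step in `stub_gammaArithmetic`: for `1 ≤ c ≤ t`,
`(t+c)^c ≤ (2t)^c = 2^c t^c` and `x + 2 ≤ 2x` for `x ≥ 2` give
`2 ((t+c)^c + 2)^2 ≤ 8 · 4^c · t^(2c) = 2^(2c+3) t^(2c)`. Pure `pow` manipulation, no logs.
-/

-- `Summit.ValiantsHypothesis.ValiantsHypothesis.…` is the tree's mandated single-conjunct layout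
-- (Sub = Summit), so the duplicated namespace component is intended.
set_option linter.dupNamespace false

namespace Summit.ValiantsHypothesis.ValiantsHypothesis.Theorems

open Summit.ValiantsHypothesis.ValiantsHypothesis.Theses.MonotoneRestoration
open Literature.Computability.AlgebraicComplexity

/-- TTRL-lite variant V22064 of `stub_gammaArithmetic` (stmt-ValiantsHypothesis-15886):
for `1 ≤ c ≤ t`, `2 ((t+c)^c + 2)^2 ≤ 2^(2c+3) t^(2c)`.  Tight at `c = t = 1` (`32 ≤ 32`). -/
theorem stub_gammaArithmetic_var22064 :
    ∀ (c t : ℕ), 1 ≤ c → c ≤ t →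
      2 * (((t + c) ^ c + 2) * ((t + c) ^ c + 2)) ≤ 2 ^ (2 * c + 3) * t ^ (2 * c) := by
  intro c t hc hct
  -- (t + c)^c ≤ (2t)^c = 2^c · t^c
  have h1 : (t + c) ^ c ≤ 2 ^ c * t ^ c := by
    rw [← mul_pow]
    exact Nat.pow_le_pow_left (by omega) c
  -- (t + c)^c ≥ 2, hence (t + c)^c + 2 ≤ 2 · (t + c)^c
  have h2 : 2 ≤ (t + c) ^ c := by
    calc 2 ≤ t + c := by omega
      _ = (t + c) ^ 1 := (pow_one _).symm
      _ ≤ (t + c) ^ c := Nat.pow_le_pow_right (by omega) hc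
  have h3 : (t + c) ^ c + 2 ≤ 2 * (2 ^ c * t ^ c) := by omega
  have h4 : 2 ^ (2 * c + 3) * t ^ (2 * c) = 8 * ((2 ^ c * t ^ c) * (2 ^ c * t ^ c)) := by
    ring
  rw [h4]
  calc 2 * (((t + c) ^ c + 2) * ((t + c) ^ c + 2))
      ≤ 2 * ((2 * (2 ^ c * t ^ c)) * (2 * (2 ^ c * t ^ c))) :=
        Nat.mul_le_mul_left 2 (Nat.mul_le_mul h3 h3)
    _ = 8 * ((2 ^ c * t ^ c) * (2 ^ c * t ^ c)) := by ring

end Summit.ValiantsHypothesis.ValiantsHypothesis.Theorems
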